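import Summits.Schanuel.Schanuel.Theorems.ZilberEacHyperplaneMixedExistence
import Summits.Schanuel.Schanuel.Theorems.ZilberEacHyperplaneSlowDensity
import Summits.Schanuel.Schanuel.Theorems.ZilberEacRealHyperplaneFastDensity
import HarnessLib

/-!
# Real hyperplanes in the MIXED fast/slow regime: Zariski density for EVERY exponent `ν` (O54 (a))

Zilber's Exponential-Algebraic Closedness, case ladder (host summit Schanuel, cell `pub-schanuel`,
seat 2, gen 12).  THEOREM R⁺⁺ (gen 8) solves the mixed system over a real hyperplane
`x_{s+1} = Σ rᵢxᵢ + c`; gen 9 (`ZilberEacRealHyperplaneFastDensity`) proved Zariski density when the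
growth exponent `ν = (d̂₀/e - Σ_{i≥1} rᵢ d̂ᵢ)/r₀` of `y₀ = e^{x₀}` is IRRATIONAL (THEOREM J).  Along
the labelled families of `ZilberEacHyperplaneMixedExistence`, in the coordinates
`(x_{s+1}, x₁, …, x_s) = (z₀/e, z₁, …, z_s)` and with power coordinate `y₀ = e^{x₀}`,

  `x₀ = x₀(ρ(m)) + ν log m + 2πi m θ`,   `θ = Σᵢ sᵢ qᵢ`,  `s = (1/(e r₀), -r₁/r₀, …, -r_s/r₀)`,

so `y₀ = e^{x₀(ρ(m))} m^{ν} e^{2πimθ}` is a ROTATING power coordinate of polynomial size: THEOREM M.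
Some `sᵢ` is irrational as soon as some `rᵢ` is (else `r₀ = 1/(e s₀)` and `rᵢ = -sᵢ r₀` are all
rational), so a direction `q` with `θ ∉ ℚ` and all leading forms non-vanishing exists.

**THEOREM (`unprojectedDense_polyFibredGraph_hyperplane_mixed_all`).**  Under the hypotheses of
THEOREM R⁺⁺ for all admissible rays (`Âⱼ ≠ 0`, `d̂₀ ≥ 1`, (i), (ii)) and `∃ i, rᵢ ∉ ℚ` (= additive
freeness): `I(W ∩ Γ_exp) = I(W)` — for EVERY real `ν`.  Supersedes gen 9's mixed theorem
(`ν ∉ ℚ ⟹ ∃ i, rᵢ ∉ ℚ`).  With `ZilberEacHyperplaneSlowDensity`: over real hyperplanes, BOTH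
moving-lattice regimes of the cell (slow R⁺, mixed R⁺⁺) give Zariski density for every member.

* `fastBack_zero_add_smul_add_smul` (the eliminated coordinate along a labelled family),
  `eval_bind₁_scaleVec`, `exists_irrational_fastCoeff`; the theorem; certified members
  `polyFibredGraph_hyperplane_mixed_member_dense` (examples: `ZilberEacHyperplaneMixedExamples`).

HONEST FRAMING: explicit families inside an OPEN cell; `EC(3,2)` OPEN; NOT Schanuel's conjecture;
EAC ⇏ SC.
-/

noncomputable section

open Complex MvPolynomial Filter Topology
open Literature.NumberTheory.Transcendental Literature.ModelTheory.Zilber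
  Literature.ModelTheory.ExponentialFields

set_option linter.dupNamespace false

namespace Summit.Schanuel.Schanuel.Theorems

section MixedDensity

variable {s t : ℕ}

/-- The eliminated coordinate along a labelled family: `x₀(ρ + L d + Y q) = x₀(ρ) + L ν(d) + Y ν(q)`
with `ν(v) = (v₀/e - Σ_{i≥1} rᵢ vᵢ)/r₀`. [folklore] -/
theorem fastBack_zero_add_smul_add_smul (r : Fin (s + 1) → ℝ) (c : ℂ) (e : ℕ)
    (ρ d q : Fin (s + 1) → ℂ) (L Y : ℂ) :
    fastBack r c e (ρ + L • d + Y • q) 0 = fastBack r c e ρ 0 +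
      L * ((d 0 / (e : ℂ) - ∑ i : Fin s, (r i.succ : ℂ) * d i.succ) / (r 0 : ℂ)) +
      Y * ((q 0 / (e : ℂ) - ∑ i : Fin s, (r i.succ : ℂ) * q i.succ) / (r 0 : ℂ)) := by
  simp only [fastBack_zero, Pi.add_apply, Pi.smul_apply, smul_eq_mul]
  have h : ∀ i : Fin s, (r i.succ : ℂ) * (ρ i.succ + L * d i.succ + Y * q i.succ) =
      (r i.succ : ℂ) * ρ i.succ + L * ((r i.succ : ℂ) * d i.succ) + Y * ((r i.succ : ℂ) * q i.succ) :=
    fun i => by ring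
  simp only [h, Finset.sum_add_distrib, ← Finset.mul_sum]
  simp only [div_eq_mul_inv]
  ring

/-- Evaluating a coordinate scaling: `(bind₁ (C κ · X) G)(x) = G(κ ⊙ x)`. [folklore] -/
theorem eval_bind₁_scaleVec (G : MvPolynomial (Fin t) ℂ) (κ x : Fin t → ℂ) :
    eval x (bind₁ (fun i => C (κ i) * X i) G) = eval (fun i => κ i * x i) G := by
  change eval₂Hom (RingHom.id ℂ) x (bind₁ _ G) = _
  rw [eval₂Hom_bind₁]
  have : (fun i => eval₂Hom (RingHom.id ℂ) x (C (κ i) * X i : MvPolynomial (Fin t) ℂ)) =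
      fun i => κ i * x i := by
    funext i; simp
  rw [this]
  rfl

/-- The phase coefficients `s = (1/(e r₀), -r₁/r₀, …)` have an irrational entry when some `rᵢ` is
irrational (`r₀ ≠ 0`, `e ≥ 1`). [folklore] -/
theorem exists_irrational_fastCoeff (r : Fin (s + 1) → ℝ) (hr : r 0 ≠ 0) (e : ℕ) (he : 0 < e)
    (hirr : ∃ i, Irrational (r i)) :
    ∃ i, Irrational ((Fin.cons (1 / ((e : ℝ) * r 0)) (fun i : Fin s => -r i.succ / r 0) :
      Fin (s + 1) → ℝ) i) := by
  by_contra hall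
  push Not at hall
  have h0 := hall 0
  simp only [Fin.cons_zero, Irrational, Set.mem_range, not_not] at h0
  obtain ⟨ρ₀, hρ₀⟩ := h0
  have he0 : (e : ℝ) ≠ 0 := by exact_mod_cast he.ne'
  have hρ₀0 : (ρ₀ : ℝ) ≠ 0 := by rw [hρ₀]; positivity
  have hr0 : r 0 = ((1 / ((e : ℚ) * ρ₀) : ℚ) : ℝ) := by
    push_cast
    rw [hρ₀]
    field_simp
  obtain ⟨i, hi⟩ := hirr
  apply hi
  refine Fin.cases ?_ (fun j => ?_) i
  · exact ⟨_, hr0.symm⟩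
  · have hj := hall j.succ
    simp only [Fin.cons_succ, Irrational, Set.mem_range, not_not] at hj
    obtain ⟨ρj, hρj⟩ := hj
    refine ⟨-ρj * (1 / ((e : ℚ) * ρ₀)), ?_⟩
    have : r j.succ = -(ρj : ℝ) * r 0 := by
      rw [hρj]; field_simp
    rw [this, hr0]
    push_cast
    ring

/-- **THEOREM (Zariski density over real hyperplanes, mixed regime, EVERY exponent).**  See the
module docstring. (new) [cite: MantovaMasser2023, §1 p.5 (the open case dim π(V) = 2 in ℂ³×ℂˣ³)] -/
theorem unprojectedDense_polyFibredGraph_hyperplane_mixed_all (r : Fin (s + 1) → ℝ) (hr : r 0 ≠ 0)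
    (c : ℂ) (hirr : ∃ i, Irrational (r i))
    (A : Fin (s + 1) → MvPolynomial (Fin (s + 1)) ℂ) (F : Fin (s + 1) → Polynomial ℂ)
    (hF : F 0 ≠ 0) (hAh : ∀ j, fastData r c A F j ≠ 0) (hd0 : 0 < (fastData r c A F 0).totalDegree)
    (hν : (((fastData r c A F 0).totalDegree : ℝ) / ((F 0).natDegree + 1) -
        ∑ i : Fin s, r i.succ * (fastData r c A F i.succ).totalDegree) / r 0 <
      (fastData r c A F 0).totalDegree)
    (hfast : ∀ i : Fin s, F i.succ ≠ 0 →
      ((fastData r c A F 0).totalDegree : ℝ) * ((F i.succ).natDegree + 1) <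
        ((F 0).natDegree + 1) * (fastData r c A F i.succ).totalDegree) :
    UnprojectedDense (polyFibredGraph (hyperplanePoly r c) A (fun j => (F j).toMvPolynomial 0)) := by
  classical
  set e : ℕ := (F 0).natDegree + 1 with he
  have hepos : 0 < e := Nat.succ_pos _
  have heC : (e : ℂ) ≠ 0 := by exact_mod_cast hepos.ne'
  set Ah : Fin (s + 1) → MvPolynomial (Fin (s + 1)) ℂ := fastData r c A F with hAh'
  -- one good direction: leading forms non-vanishing, `θ = Σ sᵢ qᵢ` irrational
  set Lp : MvPolynomial (Fin (s + 1)) ℂ := ∏ j, homogeneousComponent (Ah j).totalDegree (Ah j) with hLp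
  have hLp0 : Lp ≠ 0 := Finset.prod_ne_zero_iff.2 fun j _ =>
    ExpDominant.homogeneousComponent_totalDegree_ne_zero (hAh j)
  set sv : Fin (s + 1) → ℝ := Fin.cons (1 / ((e : ℝ) * r 0)) (fun i : Fin s => -r i.succ / r 0) with hsv
  obtain ⟨q, hθirr, hqL⟩ := exists_int_irrational_sum_eval_ne_zero hLp0 Complex.two_pi_I_ne_zero sv
    (exists_irrational_fastCoeff r hr e hepos hirr)
  have hA : ∀ j, eval (fun i => 2 * Real.pi * I * (q i : ℂ))
      (homogeneousComponent (Ah j).totalDegree (Ah j)) ≠ 0 := by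
    rw [hLp, map_prod] at hqL
    exact fun j => (Finset.prod_ne_zero_iff.1 hqL) j (Finset.mem_univ j)
  set θ : ℝ := ∑ j, sv j * (q j : ℝ) with hθ
  set ν : ℝ := (((Ah 0).totalDegree : ℝ) / e - ∑ i : Fin s, r i.succ * (Ah i.succ).totalDegree) / r 0
    with hνdef
  set ζ : ℂ := exp (2 * Real.pi * I * (θ : ℂ)) with hζ
  have hζ1 : ‖ζ‖ = 1 := by
    rw [hζ, show (2 * Real.pi * I * (θ : ℂ)) = ((2 * Real.pi * θ : ℝ) : ℂ) * I by push_cast; ring]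
    exact Complex.norm_exp_ofReal_mul_I _
  have hroot : ∀ j : ℕ, 0 < j → ζ ^ j ≠ 1 := exp_two_pi_I_mul_pow_ne_one hθirr
  -- the complex forms of `θ` and `ν`
  have hθC : ((q 0 : ℂ) / (e : ℂ) - ∑ i : Fin s, (r i.succ : ℂ) * (q i.succ : ℂ)) / (r 0 : ℂ) = (θ : ℂ) := by
    rw [hθ, Fin.sum_univ_succ, hsv]
    simp only [Fin.cons_zero, Fin.cons_succ]
    push_cast
    rw [sub_div, div_div, Finset.sum_div, sub_eq_add_neg, ← Finset.sum_neg_distrib]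
    congr 1
    · ring
    · exact Finset.sum_congr rfl fun i _ => by ring
  have hνC : ((((Ah 0).totalDegree : ℕ) : ℂ) / (e : ℂ) -
      ∑ i : Fin s, (r i.succ : ℂ) * (((Ah i.succ).totalDegree : ℕ) : ℂ)) / (r 0 : ℂ) = (ν : ℂ) := by
    rw [hνdef]; push_cast; rfl
  -- the labels and the scaled label map `D(ρ) = (ρ₀/e, ρ₁, …)`
  set Llog : Fin (s + 1) → ℂ := fun j => log (eval (fun i => 2 * Real.pi * I * (q i : ℂ))
    (homogeneousComponent (Ah j).totalDegree (Ah j))) with hLlog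
  set κ : Fin (s + 1) → ℂ := Fin.cons (e : ℂ)⁻¹ (fun _ => 1) with hκ
  have hκ0 : ∀ i, κ i ≠ 0 := fun i => by
    refine Fin.cases ?_ (fun j => ?_) i
    · simp only [hκ, Fin.cons_zero]; exact inv_ne_zero heC
    · simp [hκ]
  refine unprojectedDense_of_rotating_power (t := s + 1)
    (isIrreducibleClosed_polyFibredGraph _ A _) (by rw [zariskiDim_polyFibredGraph])
    (Fin.cons (Sum.inl (Fin.last (s + 1))) (fun i : Fin s => Sum.inl (Fin.castSucc i.succ)))
    (Sum.inr (Fin.castSucc 0))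
    (fun j => κ j * (((Ah j).totalDegree : ℕ) : ℂ)) (fun j => κ j * (q j : ℂ)) ν hζ1 hroot
    (U := {ρ' | ∃ p : Fin (s + 1) → ℤ, ρ' = fun j => κ j * (2 * Real.pi * I * (p j : ℂ) + Llog j)})
    (fun G hG => ?_) ?_
  · obtain ⟨pv, hpv⟩ := exists_int_eval_translate_ne_zero (bind₁_scaleVec_ne_zero hG hκ0) Llog
      (a := 2 * Real.pi * I) Complex.two_pi_I_ne_zero
    refine ⟨_, ⟨pv, rfl⟩, ?_⟩
    rw [eval_bind₁_scaleVec] at hpv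
    have e' : (fun i => κ i * (Llog i + 2 * Real.pi * I * (pv i : ℂ))) =
        fun j => κ j * (2 * Real.pi * I * (pv j : ℂ) + Llog j) := by
      funext i; ring
    rwa [e'] at hpv
  rintro ρ₀ ⟨p, rfl⟩
  obtain ⟨z, ρ, hsol, hz, hρ⟩ := exists_solutions_hyperplane_mixed r hr c q A F hF hA hd0 hν hfast p
  -- the points, the sequences
  set x : ℕ → Fin (s + 1) → ℂ := fun m => fastBack r c e (z m) with hx
  set P : ℕ → Fin (s + 2) ⊕ Fin (s + 2) → ℂ := fun m =>
    pgParam (hyperplanePoly r c) A (fun j => (F j).toMvPolynomial 0) (x m) (exp (ell r c (x m))) with hP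
  have hexpm : ∀ m : ℕ, 1 ≤ m → exp (((Real.log m : ℝ)) : ℂ) = (m : ℂ) := by
    intro m hm
    rw [← Complex.ofReal_exp, Real.exp_log (by exact_mod_cast hm)]
    push_cast
    rfl
  have hsol' : ∀ᶠ m : ℕ in atTop, ∀ j, exp (x m j) = eval (x m) (A j) +
      exp (∑ i, (r i : ℂ) * x m i + c) * (F j).eval (exp (∑ i, (r i : ℂ) * x m i + c)) := by
    filter_upwards [hsol] with m hm j
    have h := hm j
    simp only [ell] at h
    exact h
  refine ⟨P, fun m j => κ j * (ρ m j + ((Real.log m : ℝ) : ℂ) * (((Ah j).totalDegree : ℕ) : ℂ)),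
    fun m => Real.log m, fun m => 2 * Real.pi * I * (m : ℂ),
    fun m => 2 * Real.pi * I * (m : ℂ) / exp (((Real.log m : ℝ)) : ℂ),
    fun m => exp (fastBack r c e (ρ m) 0), 2 * Real.pi * I,
    exp (fastBack r c e (fun j => 2 * Real.pi * I * (p j : ℂ) + Llog j) 0),
    ?_, ?_, ?_, ?_, fun m => ?_, ?_, Complex.two_pi_I_ne_zero, ?_, ?_, Complex.exp_ne_zero _⟩
  · -- points of `W ∩ Γ_exp`
    filter_upwards [hsol'] with m hm
    refine ⟨pgParam_mem _ _ _ _ _, ?_⟩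
    have h := pgParam_hyperplane_mem_expGraph r c A F hm
    simp only [hP, ell]
    exact h
  · -- the coordinates `(x_{s+1}, x₁, …, x_s) = (z₀/e, z₁, …, z_s)`
    filter_upwards with m
    funext i
    refine Fin.cases ?_ (fun j => ?_) i
    · simp only [Fin.cons_zero, hP, pgParam_inl_last, eval_hyperplanePoly, Pi.add_apply, Pi.smul_apply,
        smul_eq_mul]
      rw [hx]
      dsimp only
      rw [ell_fastBack hr, hz m]
      simp only [Pi.add_apply, Pi.smul_apply, smul_eq_mul, hκ, Fin.cons_zero]
      field_simp
      ring
    · simp only [Fin.cons_succ, hP, pgParam_inl_castSucc, Pi.add_apply, Pi.smul_apply, smul_eq_mul]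
      rw [hx]
      dsimp only
      rw [fastBack_succ, hz m]
      simp only [Pi.add_apply, Pi.smul_apply, smul_eq_mul, hκ, Fin.cons_succ]
      ring
  · exact Real.tendsto_log_atTop.comp tendsto_natCast_atTop_atTop
  · -- the transversal part converges to `D(ρ_p)`
    have hlim : Tendsto (fun m => fun j => κ j * ρ m j) atTop
        (𝓝 fun j => κ j * (2 * Real.pi * I * (p j : ℂ) + Llog j)) := by
      refine tendsto_pi_nhds.2 fun j => ?_
      exact ((continuous_apply j).tendsto _ |>.comp hρ).const_mul (κ j)
    refine hlim.congr fun m => ?_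
    funext j
    simp only [Pi.sub_apply, Pi.smul_apply, smul_eq_mul]
    ring
  · rw [mul_div_cancel₀ _ (Complex.exp_ne_zero _)]
  · -- `Y(m) = 2πi` eventually
    refine tendsto_const_nhds.congr' ?_
    filter_upwards [eventually_ge_atTop 1] with m hm
    rw [hexpm m hm, mul_div_cancel_right₀ _ (by exact_mod_cast (show m ≠ 0 by omega))]
  · -- the power coordinate `y₀ = e^{x₀} = e^{x₀(ρ(m))} m^{ν} ζ^m`
    filter_upwards [hsol'] with m hm
    have hβ : P m (Sum.inr (Fin.castSucc 0)) = exp (x m 0) := by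
      simp only [hP, pgParam_inr, pMulParam_castSucc, MvPolynomial.eval_toMvPolynomial, Fin.cons_zero]
      rw [hm 0, ell]
    rw [hβ, hx]
    dsimp only
    rw [hz m, fastBack_zero_add_smul_add_smul, hθC, hνC, hζ, ← Complex.exp_nat_mul, ← Complex.exp_add,
      ← Complex.exp_add]
    congr 1
    push_cast
    ring
  · -- `C(m) → C₀`
    have hcont : Continuous fun ρ' : Fin (s + 1) → ℂ => fastBack r c e ρ' 0 := by
      have : (fun ρ' : Fin (s + 1) → ℂ => fastBack r c e ρ' 0) = fun ρ' => eval ρ' (fastSubst r c e 0) := by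
        funext ρ'; rw [eval_fastSubst]
      rw [this]
      exact MvPolynomial.continuous_eval _
    exact ((Complex.continuous_exp.comp hcont).tendsto _).comp hρ

/-- **Certified members with dense exponential points, mixed regime, every `ν`.**  `A` dominant,
some `rᵢ ∉ ℚ`, the hypotheses of THEOREM R⁺⁺ for all admissible rays: all seven hypotheses of
`ECCell (s+2) (s+1)`, not linearly split, `W ∩ Γ_exp ≠ ∅`, `I(W ∩ Γ_exp) = I(W)`. (new)
[cite: MantovaMasser2023, §1 p.5 (the open case dim π(V) = 2 in ℂ³×ℂˣ³)] -/
theorem polyFibredGraph_hyperplane_mixed_member_dense (r : Fin (s + 1) → ℝ) (hr : r 0 ≠ 0) (c : ℂ)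
    (hirr : ∃ i, Irrational (r i)) (A : Fin (s + 1) → MvPolynomial (Fin (s + 1)) ℂ)
    (hAinj : Function.Injective
      (aeval A : MvPolynomial (Fin (s + 1)) ℂ →ₐ[ℂ] MvPolynomial (Fin (s + 1)) ℂ))
    (F : Fin (s + 1) → Polynomial ℂ) (hF : F 0 ≠ 0) (hAh : ∀ j, fastData r c A F j ≠ 0)
    (hd0 : 0 < (fastData r c A F 0).totalDegree)
    (hν : (((fastData r c A F 0).totalDegree : ℝ) / ((F 0).natDegree + 1) -
        ∑ i : Fin s, r i.succ * (fastData r c A F i.succ).totalDegree) / r 0 <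
      (fastData r c A F 0).totalDegree)
    (hfast : ∀ i : Fin s, F i.succ ≠ 0 →
      ((fastData r c A F 0).totalDegree : ℝ) * ((F i.succ).natDegree + 1) <
        ((F 0).natDegree + 1) * (fastData r c A F i.succ).totalDegree) :
    (IsIrreducibleClosed ℂ (polyFibredGraph (hyperplanePoly r c) A (fun j => (F j).toMvPolynomial 0)) ∧
      (polyFibredGraph (hyperplanePoly r c) A (fun j => (F j).toMvPolynomial 0) ∩
        torusLocus ℂ (s + 2)).Nonempty ∧
      IsRotund ℂ (s + 2) (polyFibredGraph (hyperplanePoly r c) A (fun j => (F j).toMvPolynomial 0) ∩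
        torusLocus ℂ (s + 2)) ∧
      IsAddFree ℂ (s + 2) (polyFibredGraph (hyperplanePoly r c) A (fun j => (F j).toMvPolynomial 0) ∩
        torusLocus ℂ (s + 2)) ∧
      IsMulFree ℂ (s + 2) (polyFibredGraph (hyperplanePoly r c) A (fun j => (F j).toMvPolynomial 0) ∩
        torusLocus ℂ (s + 2)) ∧
      zariskiDim ℂ (polyFibredGraph (hyperplanePoly r c) A (fun j => (F j).toMvPolynomial 0)) =
        (s + 2 : ℕ) ∧
      addProjDim ℂ (s + 2) (polyFibredGraph (hyperplanePoly r c) A (fun j => (F j).toMvPolynomial 0)) =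
        (s + 1 : ℕ)) ∧
    ¬ IsLinearSplit ℂ (s + 2) (polyFibredGraph (hyperplanePoly r c) A (fun j => (F j).toMvPolynomial 0)) ∧
    (polyFibredGraph (hyperplanePoly r c) A (fun j => (F j).toMvPolynomial 0) ∩
      expGraph ℂ (s + 2)).Nonempty ∧
    UnprojectedDense (polyFibredGraph (hyperplanePoly r c) A (fun j => (F j).toMvPolynomial 0)) := by
  have hcell := ecCell_hypotheses_polyFibredGraph_hyperplane r c A (fun j => (F j).toMvPolynomial 0)
    hAinj hirr
  have hdense := unprojectedDense_polyFibredGraph_hyperplane_mixed_all r hr c hirr A F hF hAh hd0 hν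
    hfast
  refine ⟨hcell, not_isLinearSplit_polyFibredGraph _ A _ (Nat.succ_pos s) hAinj, ?_, hdense⟩
  obtain ⟨w, hw, -⟩ := hcell.2.1
  exact inter_expGraph_nonempty_of_vanishingIdeal_eq ⟨w, hw⟩ hdense

end MixedDensity

end Summit.Schanuel.Schanuel.Theorems

end
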